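import Literature.NumberTheory.EllipticCurves.ModFiveCongruenceHessePolynomials
import Literature.NumberTheory.EllipticCurves.BSDSelmerSmithCasesProofs
import HarnessLib

/-!
# Mod-`5` congruences of elliptic curves from Fisher's Hesse families (`X_E(5) ≅ ℙ¹` and its
# indirect twin): the two printed families as named facts, and a certificate form for explicit pairs

Topic `Literature/NumberTheory/EllipticCurves`, namespace
`Literature.NumberTheory.EllipticCurves.HesseFamilyFive`. Part II (Part I = `ModFiveCongruenceHessePolynomials`: the printed
polynomials `D, C4, C6, Di, C4i, C6i`). Statement file (D-0014): TWO named facts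
(published theorems, refereed: T. Fisher, *The Hessian of a genus one curve*, Proc. LMS (3) **104**
(2012) 613–648, Thm. 13.2 with §8; T. Fisher, *Invariant theory for the elliptic normal quintic, I.
Twists of X(5)*, Math. Ann. **356** (2013) 589–616, Thm. 5.8 with Lemma 5.6), the printed polynomials
(Part I), and PROVED plumbing turning the facts into a finite
certificate for a concrete pair of curves. Cell `bsd-potss`, seat `bsd-potss-conjA-anchor` g7
(congruence-anchor census of the Conj-A cruxes at `p = 5`). HONEST FRAMING: nothing here bears on BSD;
the facts replace, for `p = 5`, the displayed hypothesis «`W′[5] ≃ W[5]`, evidence = a Kraus–Oesterlé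
trace certificate» of the census road files by «named PUB fact + a kernel-checked identity between
rational numbers»; typed ≠ proved ≠ endorsed.

## The printed statements

Both papers work over a (perfect) field `K` of characteristic not dividing `30` ([Fisher2012Hessian]
§1: «We work over a perfect field `K` of characteristic not dividing `6n`»; [Fisher2013TwistsOfX5] §5:
«`K` will be a field of characteristic `0`»). Elliptic curves `E, E'` over `K` are *`n`-congruent* if
`E[n] ≅ E'[n]` as Galois modules; *directly* `n`-congruent if some such isomorphism respects the Weil
pairing, *indirectly* (`n = 5`) if it raises it to the power `r ∈ {2, 3}` ([Fisher2012Hessian]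
Def. 13.1; [Fisher2013TwistsOfX5] Def. 5.1 and the paragraph before Thm. 5.8).

* [Fisher2012Hessian] §8 (after Lemma 8.4): the HESSE POLYNOMIALS `𝔇(λ,μ), 𝔠₄(λ,μ), 𝔠₆(λ,μ) ∈
  K[c₄,c₆][λ,μ]`; for `n = 5`, `𝔇` is the degree-`12` form `D` below (VERBATIM), and
  «`𝔠₄(λ,μ) = −1/((deg 𝔇)²((deg 𝔇)−1)²) · |∂²𝔇/∂λ², ∂²𝔇/∂λ∂μ; ∂²𝔇/∂λ∂μ, ∂²𝔇/∂μ²|`»,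
  «`𝔠₆(λ,μ) = 1/(deg 𝔇 · deg c₄) · |∂𝔇/∂λ, ∂𝔇/∂μ; ∂𝔠₄/∂λ, ∂𝔠₄/∂μ|`» (`deg 𝔇 = 12`,
  `deg c₄ = 4n/(6−n) = 20`), related by `𝔠₄³ − 𝔠₆² = (c₄³ − c₆²) 𝔇⁵` (display (syz)).
  **Theorem 13.2** (`n ∈ {2,3,4,5}`): «Let `E` be an elliptic curve over `K`, `y² = x³ − 27c₄x − 54c₆`,
  and let `E_{λ,μ}` be the family of curves `y² = x³ − 27𝔠₄(λ,μ)x − 54𝔠₆(λ,μ)` where the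
  coefficients of the Hesse polynomials `𝔠₄(λ,μ)` and `𝔠₆(λ,μ)` are evaluated at `c₄, c₆ ∈ K`. Then an
  elliptic curve `E'` over `K` is directly `n`-congruent to `E` if and only if it is isomorphic over `K`
  to `E_{λ,μ}` for some `λ, μ ∈ K`.»
* [Fisher2013TwistsOfX5] Lemma 5.6: the polynomials `𝔇, 𝔠₄, 𝔠₆` of the INDIRECT family; `𝔇` is the
  degree-`12` form `Di` below (VERBATIM), «`𝔠₄(λ,μ) = −1/(11²·12²) |Hessian(𝔇)|`»,
  «`𝔠₆(λ,μ) = −1/(12·20) |∂𝔇/∂λ, ∂𝔇/∂μ; ∂𝔠₄/∂λ, ∂𝔠₄/∂μ|`», «`𝔠₄³ − 𝔠₆² = (c₄³ − c₆²)² 𝔇⁵`»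
  («We have contributed them to Magma as `HessePolynomials(5,2,[c4,c6])`»). **Theorem 5.8**: «Let `E`
  be an elliptic curve over `K` with Weierstrass equation `y² = x³ − 27c₄x − 54c₆`. Then the family of
  elliptic curves parametrised by `Y_E^{(2)}(5)` is `E_{λ,μ} : y² = x³ − 12𝔠₄(λ,μ)x − 16𝔠₆(λ,μ)`»
  (proof, part (i): for `E_{λ,μ}` non-singular, «`E` and `E_{λ,μ}` are indirectly `5`-congruent»).

## Faithfulness (hypotheses complete; weaker than print where it differs, never stronger)

The facts below take the SPECIAL CASE `K = ℚ`, `E' = E_{λ,μ}` itself (so «isomorphic over `K` to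
`E_{λ,μ}`» is the identity) with `E_{λ,μ}` an elliptic curve (`IsElliptic`, i.e. non-singular — the
word «elliptic curve `E'`» of both theorems), and conclude only the Galois-module isomorphism
`E_{λ,μ}[5] ≃ E[5]` (the Weil-pairing clause is dropped — weaker). The conclusion is spelled as the
tree's idiom for `E₁[p] ≅ E₂[p]` (an additive isomorphism of `WeierstrassCurve.geomTorsion`
commuting with `Γ_ℚ`, `GaloisAction.lean`; for `ℚ` this is VERBATIM the body of the Summits-side
abbreviation `Rank1Residual.O6.ModPCongruent E_{λ,μ} E 5`).
`-- TODO(general form): any perfect field of characteristic prime to 30, and the converse direction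
-- (every directly / indirectly 5-congruent E' is K-isomorphic to some member), not needed by the census.`
The polynomials `𝔠₄, 𝔠₆` are DEFINED (Part I) by the printed determinantal formulas from the printed
`𝔇` and its term-by-term partial derivatives (listed explicitly, orders 1–3: `Dl … Dmmm`); the seat's
exact engine (pub/bsd-potss/conjA-anchor/g7/kit/hesse5.py, gen_lean_polys.py) checked that these
definitions expand to polynomials with INTEGER coefficients satisfying both printed syzygies
identically, that the direct family returns `(c₄, c₆)` at `(λ:μ) = (1:0)` (`C4_one_zero`,
`C6_one_zero`, Part I, PROVED), and that all Kraus–Oesterlé-certified `5`-congruent pairs of the census of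
record tried (STEP-0) are members of exactly one of the two families.

## Contents

* (Part I) `D, …, C4, C6` (direct) and `Di, …, C4i, C6i` (indirect): DEFINITIONS.
* `thm132_geomTorsionFive_of_hesseFamily` (NAMED FACT, PUB, [Fisher2012Hessian] Thm. 13.2 (i), n = 5).
* `thm58_geomTorsionFive_of_dualHesseFamily` (NAMED FACT, PUB, [Fisher2013TwistsOfX5] Thm. 5.8 (i)).
* PROVED: `Congr` plumbing (`congr_refl/symm/trans`, `congr_smul`), the `c₄c₆`-model
  `fisherChange_smul` (every `W/ℚ` is `ℚ`-isomorphic to `y² = x³ − 27c₄(W)x − 54c₆(W)`), and the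
  CERTIFICATE FORMS `congr_of_directCertificate` / `congr_of_indirectCertificate`: for elliptic
  `W, W'/ℚ` and rationals `l, m, v` with `W'.c₄ = v⁴·𝔠₄(l,m)`, `W'.c₆ = v⁶·𝔠₆(l,m)` (Hesse
  polynomials of `(W.c₄, W.c₆)`; indirect: `W'.c₄ = (4/9)v⁴𝔠₄`, `W'.c₆ = (8/27)v⁶𝔠₆`), the fact
  gives `W'[5] ≃ W[5]` `Γ_ℚ`-equivariantly — four rational identities per pair, closed by `norm_num`.

## References

* [Fisher2012Hessian] T. Fisher, Proc. LMS (3) 104 (2012) 613–648, §8 (Hesse polynomials, n = 5),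
  Def. 13.1, Thm. 13.2 (arXiv:math/0610403, chunks p0012–p0013, p0019).
* [Fisher2013TwistsOfX5] T. Fisher, Math. Ann. 356 (2013) 589–616, Def. 5.1, Lemma 5.6, Thm. 5.8
  (arXiv:1110.3520, chunks p0010–p0011).
* [SilvermanAEC2009] III.1 (the `c₄, c₆` model), III.§7 (Galois action on torsion).
-/

noncomputable section

open scoped Classical

namespace Literature.NumberTheory.EllipticCurves.HesseFamilyFive

open WeierstrassCurve

/-! ## §3 The congruence relation (tree idiom) and its plumbing — PROVED -/

/-- `W₁[5] ≃ W₂[5]` `Γ_ℚ`-equivariantly: the tree's inline idiom for a mod-`p` congruence at `p = 5`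
(an additive isomorphism of `geomTorsion` commuting with the Galois action; for `ℚ` VERBATIM the body
of `Summit…Rank1Residual.O6.ModPCongruent W₁ W₂ 5`). Serre (1972) §4; Silverman, *AEC* III.§7.
[cite: SilvermanAEC2009, III.§7 (the Galois module E[m])] -/
def Congr (W₁ W₂ : WeierstrassCurve ℚ) : Prop :=
  ∃ e : W₁.geomTorsion 5 ≃+ W₂.geomTorsion 5,
    ∀ (σ : Field.absoluteGaloisGroup ℚ) (P : W₁.geomTorsion 5), e (σ • P) = σ • e P

/-- `5`-congruence is reflexive. [cite: SilvermanAEC2009, III.§7] -/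
theorem congr_refl (W : WeierstrassCurve ℚ) : Congr W W :=
  ⟨AddEquiv.refl _, fun _ _ => rfl⟩

/-- `5`-congruence is symmetric (the inverse of an equivariant isomorphism is equivariant).
[cite: SilvermanAEC2009, III.§7] -/
theorem congr_symm {W₁ W₂ : WeierstrassCurve ℚ} (h : Congr W₁ W₂) : Congr W₂ W₁ := by
  obtain ⟨e, he⟩ := h
  refine ⟨e.symm, fun σ Q => ?_⟩
  apply e.injective
  rw [he, e.apply_symm_apply, e.apply_symm_apply]

/-- `5`-congruence is transitive. [cite: SilvermanAEC2009, III.§7] -/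
theorem congr_trans {W₁ W₂ W₃ : WeierstrassCurve ℚ} (h₁ : Congr W₁ W₂) (h₂ : Congr W₂ W₃) :
    Congr W₁ W₃ := by
  obtain ⟨e₁, he₁⟩ := h₁
  obtain ⟨e₂, he₂⟩ := h₂
  exact ⟨e₁.trans e₂, fun σ P => by rw [AddEquiv.trans_apply, AddEquiv.trans_apply, he₁, he₂]⟩

/-- A change of Weierstrass model over `ℚ` is a `5`-congruence (tree:
`WeierstrassCurve.exists_geomTorsion_addEquiv_smul`): isomorphic curves have isomorphic torsion
Galois modules. [cite: SilvermanAEC2009, III.§7 with III.1 (isomorphic Weierstrass equations)] -/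
theorem congr_smul (W : WeierstrassCurve ℚ) (C : WeierstrassCurve.VariableChange ℚ) : Congr W (C • W) :=
  WeierstrassCurve.exists_geomTorsion_addEquiv_smul W C 5

/-- `congr_smul` along an equation `C • W = E`. [cite: SilvermanAEC2009, III.§7 with III.1] -/
theorem congr_of_smul_eq {W E : WeierstrassCurve ℚ} (C : WeierstrassCurve.VariableChange ℚ)
    (h : C • W = E) : Congr W E := by
  rw [← h]; exact congr_smul W C

/-! ## §4 The `c₄c₆`-model `y² = x³ − 27c₄x − 54c₆` of a curve over `ℚ` — PROVED -/

/-- The change of variables `u = 1/6`, `r = −b₂/12`, `s = −a₁/2`, `t = −(a₃ − a₁b₂/12)/2` taking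
`W/ℚ` to its `c₄c₆`-model. Silverman, *AEC* III.1. [cite: SilvermanAEC2009, III.1 (p. 42–43)] -/
def fisherChange (W : WeierstrassCurve ℚ) : WeierstrassCurve.VariableChange ℚ :=
  ⟨Units.mk0 (1 / 6) (by norm_num), -W.b₂ / 12, -W.a₁ / 2, -(W.a₃ - W.a₁ * W.b₂ / 12) / 2⟩

/-- Every `W/ℚ` is `ℚ`-isomorphic to `y² = x³ − 27c₄(W)x − 54c₆(W)` (the model of
[Fisher2012Hessian] Thm. 13.2). [cite: SilvermanAEC2009, III.1] -/
theorem fisherChange_smul (W : WeierstrassCurve ℚ) :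
    fisherChange W • W = ⟨0, 0, 0, -27 * W.c₄, -54 * W.c₆⟩ := by
  ext <;> simp only [fisherChange, WeierstrassCurve.variableChange_a₁, WeierstrassCurve.variableChange_a₂,
    WeierstrassCurve.variableChange_a₃, WeierstrassCurve.variableChange_a₄,
    WeierstrassCurve.variableChange_a₆, Units.val_inv_eq_inv_val, Units.val_mk0,
    WeierstrassCurve.b₂, WeierstrassCurve.b₄, WeierstrassCurve.b₆, WeierstrassCurve.c₄,
    WeierstrassCurve.c₆] <;> ring

/-- `W[5] ≃ E[5]` for the `c₄c₆`-model `E : y² = x³ − 27c₄(W)x − 54c₆(W)` of `W`.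
[cite: SilvermanAEC2009, III.1 with III.§7] -/
theorem congr_fisherModel (W : WeierstrassCurve ℚ) :
    Congr W ⟨0, 0, 0, -27 * W.c₄, -54 * W.c₆⟩ :=
  congr_of_smul_eq (fisherChange W) (fisherChange_smul W)

/-- The `c₄c₆`-model of an elliptic curve is elliptic (a change of variables preserves `Δ ≠ 0`).
[cite: SilvermanAEC2009, III.1 (Table 3.1: u¹²Δ′ = Δ)] -/
theorem isElliptic_fisherModel (W : WeierstrassCurve ℚ) [W.IsElliptic] :
    (⟨0, 0, 0, -27 * W.c₄, -54 * W.c₆⟩ : WeierstrassCurve ℚ).IsElliptic := by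
  rw [← fisherChange_smul]; infer_instance

/-- Rescaling a short model: `⟨v⁻¹, 0, 0, 0⟩ • (y² = x³ + a₄x + a₆) = (y² = x³ + v⁴a₄x + v⁶a₆)`.
[cite: SilvermanAEC2009, III.1 Table 3.1] -/
theorem scale_smul_short (v : ℚ) (hv : v ≠ 0) (a₄ a₆ : ℚ) :
    (⟨Units.mk0 v⁻¹ (inv_ne_zero hv), 0, 0, 0⟩ : WeierstrassCurve.VariableChange ℚ) •
        (⟨0, 0, 0, a₄, a₆⟩ : WeierstrassCurve ℚ) = ⟨0, 0, 0, v ^ 4 * a₄, v ^ 6 * a₆⟩ := by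
  ext <;> simp only [WeierstrassCurve.variableChange_a₁, WeierstrassCurve.variableChange_a₂,
    WeierstrassCurve.variableChange_a₃, WeierstrassCurve.variableChange_a₄,
    WeierstrassCurve.variableChange_a₆, Units.val_inv_eq_inv_val, Units.val_mk0, inv_inv] <;> ring

/-! ## §5 The two printed families as named facts (PUB) -/

/-- **Fisher 2012, Theorem 13.2 (direction (i)), `n = 5`, over `K = ℚ`, Galois-module form.** For
`c₄, c₆, λ, μ ∈ ℚ` such that `E : y² = x³ − 27c₄x − 54c₆` and the member
`E_{λ,μ} : y² = x³ − 27𝔠₄(λ,μ)x − 54𝔠₆(λ,μ)` of the Hesse family of `E` (direct Hesse polynomials of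
§8 evaluated at `c₄, c₆`) are both elliptic curves, `E_{λ,μ}` is directly `5`-congruent to `E`; in
particular `E_{λ,μ}[5] ≃ E[5]` as `Γ_ℚ`-modules. Statement-only (no `_holds`): the printed proof goes
through the invariant theory of genus-one models of degree `5` and Heisenberg groups (§§4–13).
`-- TODO(general form): perfect K with char ∤ 30; converse (ii); the Weil-pairing clause.`
[cite: Fisher2012Hessian, Thm. 13.2 (i) with Def. 13.1 and §8 (n = 5), PLMS 104 (2012) pp. 613–648 (arXiv:math/0610403 chunks p0012, p0019)] -/
def thm132_geomTorsionFive_of_hesseFamily : Prop :=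
  ∀ (E E' : WeierstrassCurve ℚ) [E.IsElliptic] [E'.IsElliptic] (c₄ c₆ l m : ℚ),
    E = ⟨0, 0, 0, -27 * c₄, -54 * c₆⟩ →
    E' = ⟨0, 0, 0, -27 * C4 c₄ c₆ l m, -54 * C6 c₄ c₆ l m⟩ →
      ∃ e : E'.geomTorsion 5 ≃+ E.geomTorsion 5,
        ∀ (σ : Field.absoluteGaloisGroup ℚ) (P : E'.geomTorsion 5), e (σ • P) = σ • e P

/-- **Fisher 2013, Theorem 5.8 (part (i) of its proof), over `K = ℚ`, Galois-module form.** For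
`c₄, c₆, λ, μ ∈ ℚ` such that `E : y² = x³ − 27c₄x − 54c₆` and the member
`E_{λ,μ} : y² = x³ − 12𝔠₄(λ,μ)x − 16𝔠₆(λ,μ)` of the INDIRECT family (Hesse polynomials of Lemma 5.6
evaluated at `c₄, c₆`) are both elliptic curves, `E` and `E_{λ,μ}` are indirectly `5`-congruent; in
particular `E_{λ,μ}[5] ≃ E[5]` as `Γ_ℚ`-modules. Statement-only (no `_holds`).
`-- TODO(general form): any field of characteristic 0; part (ii) (completeness of the family).`
[cite: Fisher2013TwistsOfX5, Thm. 5.8 with Lemma 5.6 and Def. 5.1, Math. Ann. 356 (2013) pp. 589–616 (arXiv:1110.3520 chunks p0010–p0011)] -/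
def thm58_geomTorsionFive_of_dualHesseFamily : Prop :=
  ∀ (E E' : WeierstrassCurve ℚ) [E.IsElliptic] [E'.IsElliptic] (c₄ c₆ l m : ℚ),
    E = ⟨0, 0, 0, -27 * c₄, -54 * c₆⟩ →
    E' = ⟨0, 0, 0, -12 * C4i c₄ c₆ l m, -16 * C6i c₄ c₆ l m⟩ →
      ∃ e : E'.geomTorsion 5 ≃+ E.geomTorsion 5,
        ∀ (σ : Field.absoluteGaloisGroup ℚ) (P : E'.geomTorsion 5), e (σ • P) = σ • e P

/-! ## §6 Certificate forms for explicit pairs — PROVED (conditional on the named facts only) -/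

/-- **Direct certificate.** For elliptic `W, W'/ℚ`: if `W'.c₄ = v⁴𝔠₄(l,m)` and `W'.c₆ = v⁶𝔠₆(l,m)`
for the direct Hesse polynomials of `(W.c₄, W.c₆)` and rationals `l, m, v`, `v ≠ 0`, then (given
[Fisher2012Hessian] Thm. 13.2) `W'[5] ≃ W[5]` `Γ_ℚ`-equivariantly. Proof: `W ≅ E` (its `c₄c₆`-model),
`W' ≅ E_W' ≅ E_{l,m}` (its `c₄c₆`-model is the `v`-rescaling of the member), and the fact.
[cite: Fisher2012Hessian, Thm. 13.2 (i)] -/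
theorem congr_of_directCertificate (hF : thm132_geomTorsionFive_of_hesseFamily)
    (W W' : WeierstrassCurve ℚ) [W.IsElliptic] [W'.IsElliptic] (c₄ c₆ l m v : ℚ) (hv : v ≠ 0)
    (hc₄ : W.c₄ = c₄) (hc₆ : W.c₆ = c₆)
    (h₄ : W'.c₄ = v ^ 4 * C4 c₄ c₆ l m) (h₆ : W'.c₆ = v ^ 6 * C6 c₄ c₆ l m) :
    Congr W' W := by
  -- the two `c₄c₆`-models
  have hE : Congr W ⟨0, 0, 0, -27 * c₄, -54 * c₆⟩ := by
    have := congr_fisherModel W; rwa [hc₄, hc₆] at this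
  haveI : (⟨0, 0, 0, -27 * c₄, -54 * c₆⟩ : WeierstrassCurve ℚ).IsElliptic := by
    have := isElliptic_fisherModel W; rwa [hc₄, hc₆] at this
  -- the member `E_{l,m}` is the `v⁻¹`-rescaling of the `c₄c₆`-model of `W'`
  set E' : WeierstrassCurve ℚ := ⟨0, 0, 0, -27 * C4 c₄ c₆ l m, -54 * C6 c₄ c₆ l m⟩ with hE'def
  have hscale : (⟨Units.mk0 v⁻¹ (inv_ne_zero hv), 0, 0, 0⟩ : WeierstrassCurve.VariableChange ℚ) • E' =
      ⟨0, 0, 0, -27 * W'.c₄, -54 * W'.c₆⟩ := by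
    rw [hE'def, scale_smul_short v hv, h₄, h₆]; congr 1 <;> ring
  have hW'E' : Congr W' E' :=
    congr_trans (congr_fisherModel W') (congr_symm (congr_of_smul_eq _ hscale))
  haveI : E'.IsElliptic := by
    -- `E'` is a change of variables of the (elliptic) `c₄c₆`-model of `W'`
    have h1 : (⟨Units.mk0 v⁻¹ (inv_ne_zero hv), 0, 0, 0⟩ : WeierstrassCurve.VariableChange ℚ)⁻¹ •
        (⟨0, 0, 0, -27 * W'.c₄, -54 * W'.c₆⟩ : WeierstrassCurve ℚ) = E' := by
      rw [← hscale, inv_smul_smul]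
    haveI := isElliptic_fisherModel W'
    rw [← h1]; infer_instance
  exact congr_trans hW'E' (congr_trans (hF _ E' c₄ c₆ l m rfl hE'def) (congr_symm hE))

/-- **Indirect certificate.** For elliptic `W, W'/ℚ`: if `W'.c₄ = (4/9)v⁴𝔠₄(l,m)` and
`W'.c₆ = (8/27)v⁶𝔠₆(l,m)` for the INDIRECT Hesse polynomials of `(W.c₄, W.c₆)` and rationals
`l, m, v`, `v ≠ 0` (the member `y² = x³ − 12𝔠₄x − 16𝔠₆` has invariants `(576𝔠₄, 13824𝔠₆) =
((4/9)·6⁴𝔠₄, (8/27)·6⁶𝔠₆)`), then (given [Fisher2013TwistsOfX5] Thm. 5.8) `W'[5] ≃ W[5]`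
`Γ_ℚ`-equivariantly. [cite: Fisher2013TwistsOfX5, Thm. 5.8] -/
theorem congr_of_indirectCertificate (hF : thm58_geomTorsionFive_of_dualHesseFamily)
    (W W' : WeierstrassCurve ℚ) [W.IsElliptic] [W'.IsElliptic] (c₄ c₆ l m v : ℚ) (hv : v ≠ 0)
    (hc₄ : W.c₄ = c₄) (hc₆ : W.c₆ = c₆)
    (h₄ : W'.c₄ = 4 / 9 * v ^ 4 * C4i c₄ c₆ l m) (h₆ : W'.c₆ = 8 / 27 * v ^ 6 * C6i c₄ c₆ l m) :
    Congr W' W := by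
  have hE : Congr W ⟨0, 0, 0, -27 * c₄, -54 * c₆⟩ := by
    have := congr_fisherModel W; rwa [hc₄, hc₆] at this
  haveI : (⟨0, 0, 0, -27 * c₄, -54 * c₆⟩ : WeierstrassCurve ℚ).IsElliptic := by
    have := isElliptic_fisherModel W; rwa [hc₄, hc₆] at this
  set E' : WeierstrassCurve ℚ := ⟨0, 0, 0, -12 * C4i c₄ c₆ l m, -16 * C6i c₄ c₆ l m⟩ with hE'def
  have hscale : (⟨Units.mk0 v⁻¹ (inv_ne_zero hv), 0, 0, 0⟩ : WeierstrassCurve.VariableChange ℚ) • E' =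
      ⟨0, 0, 0, -27 * W'.c₄, -54 * W'.c₆⟩ := by
    rw [hE'def, scale_smul_short v hv, h₄, h₆]; congr 1 <;> ring
  have hW'E' : Congr W' E' :=
    congr_trans (congr_fisherModel W') (congr_symm (congr_of_smul_eq _ hscale))
  haveI : E'.IsElliptic := by
    have h1 : (⟨Units.mk0 v⁻¹ (inv_ne_zero hv), 0, 0, 0⟩ : WeierstrassCurve.VariableChange ℚ)⁻¹ •
        (⟨0, 0, 0, -27 * W'.c₄, -54 * W'.c₆⟩ : WeierstrassCurve ℚ) = E' := by
      rw [← hscale, inv_smul_smul]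
    haveI := isElliptic_fisherModel W'
    rw [← h1]; infer_instance
  exact congr_trans hW'E' (congr_trans (hF _ E' c₄ c₆ l m rfl hE'def) (congr_symm hE))

end Literature.NumberTheory.EllipticCurves.HesseFamilyFive

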